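import Summits.QuantumFields.YangMills.Theorems.BalabanUVNodesN07DbarCrossingEnds
import Summits.QuantumFields.YangMills.Theorems.UnitScaleTiltProp8ChartDoubleBarLogSecondOrder
import Summits.QuantumFields.YangMills.Theorems.UnitScaleTiltProp8ChartTransport
import Summits.QuantumFields.YangMills.Theorems.BalabanUVNodesN18CombGaugeLetters
import HarnessLib

/-!
# N07 [B11] (= [15]) Sect. F — MODULE 94: **THE DOUBLE-BAR READING OF ONE NEAR-CLASS BOND** (generic `P`, the algebra of (c′)‴): under the per-cell-site equation of a
# normalisation family `D` (MODULE 91″'s clause), the Landau copy's double-bar average `U̿^{(l)}(U^u)♮(c)` is within `r` of `1` when both ends are cells and the representative's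
# average is (`‖Ū^{(l)}_{eml}(U^{gw})♮(c) − 1‖ ≤ r`, MODULE 93 §1), within `r + 2ℓs_f + 2ℓ r s_f` (resp. `4ℓs_f + r + 4ℓ r s_f`) when the target (resp. source) is an OUT-END over a block
# of cells whose representative bond variables are within `s_f` of `1` (the block frame is then `2ℓs_f`-close to `1`, UST `norm_vframeU_sub_one_le`); and the straight block average
# `Q_l A(c)` of any potential `A` with `(U^u)♮ = e^{iηA}`, `‖A‖ ≤ s` on the reads of `c` is bounded by `(‖log U̿^{(l)}(U^u)♮(c)‖ + 64·60800·ℓ²(Lˡηs)²)∕(η·Lˡ)` (UST's second-order row)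

Cell `pub-ymgap`, seat `pub-ymgap-dag-n07-e` g28 (FAN-OUT §N07 row s3; LANE OWNER of the K0 road chart side), MODULE 94 (INTENT-94, cell bus; plan (α⁗-W) step 2 of (c′)‴).
`--kind proof --supports stmt-QuantumFields-20541 --as helper` (K0⁷); count-neutral; THEOREMS ONLY (0 `def`); generic `P`, `N ≥ 1`, ANY `Domains D`, ANY fine maps `u`, `gw`; the
representative's averages enter as ABSTRACT `SU(N)` fields `W` with the dictionary identity `Ū_{eml}((U^{gw})♮) = W♮` as a HYPOTHESIS (discharged at the record by MODULE 95 from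
dag-n07-w2's `emlIterU_unitsField_eq_iter_of_reads` on the Landau copy's reads + covariance).  [3] = [Balaban1985Averaging]; [15] = [Balaban1985Variational]; [I] = [Balaban1987RG1];
[4] = [Balaban1984PropagatorsI].

WHY.  (c′)‴ = the near rows of `Q_{j(c)}A(c)` on MODULE 77b's near class (82b∕89″'s binder `hQnear`).  By UST's second-order row ([3] Prop. 4 (134)–(135), ✓`Prop8ChartDoubleBar.
norm_mlog_dbarIterU_sub_smul_bondAvgIter_le_of_reads`) `η·Lˡ·Q_lA(c)` is `log U̿^{(l)}(e^{iηA})(c)` up to `O((Lˡηs)²)`, and `U̿^{(l)}` reads only the fine bonds under the two blocks of `c`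
(✓`dbarIterU_congr_of_agree`), where `(U^u)♮ = e^{iηA}` by the gauge equation; so a bound on `‖log U̿^{(l)}(U^u)♮(c)‖` is a bound on the near row.  MODULE 93 turns `U̿^{(l)}(U^u)♮(c)`
into the representative's `eml`-average (times one block frame at an out-end); this file does the norm bookkeeping once, generically, so that MODULE 95∕96 only SUPPLY the letters
`r` (the radial rows of MODULES 62″∕71∕81 at the representative) and `s_f` (the within-block row of 71 over a data block) at the record.

WHAT IS PROVED (sorry-free; axioms standard).
* §1 (normed ring) `norm_inv_mul_sub_one_le_of_le` (`‖v⁻¹X − 1‖ ≤ 2f + r + 2fr`, `f ≤ ½`; the product row `‖Xv − 1‖ ≤ r + f + rf` is dag-n18's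
  `YMDAG.N18.LogConjugation.norm_mul_sub_one_le_of_near`, REUSED by import — dedup).
* §2 (the three readings; hypotheses: 93's clause `hcl`, the dictionary identities, the letters) ★ `norm_dbar_sub_one_le_of_cells`, ★★ `norm_vframeU_dbar_sub_one_le_of_block`
  (`‖vframeU (U̿^{(i)}(U^u)♮) y − 1‖ ≤ 2ℓ·s_f` over a block of cells), ★★ `norm_dbar_sub_one_le_of_outEnd_tgt`, ★★ `norm_dbar_sub_one_le_of_outEnd_src`.
* §3 ★ `norm_mlog_le_two_mul_of_le` (the logarithm's Lipschitz row), ★★★ `norm_bondAvgIter_le_of_dbar_reads` — `‖Q_lA(c)‖ ≤ (m + 64·60800·ℓ²(Lˡηs)²)∕(ηLˡ)` from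
  `‖log U̿^{(l)}X(c)‖ ≤ m`, `X = e^{iηA}` and `‖A‖ ≤ s` on the reads of `c`, the budget `243200·ℓ²·Lˡ·η·s ≤ 1`.
HONEST SCOPE: norm bookkeeping over landed UST theorems and MODULE 93's identities; the dictionary identities, the rows `r ∕ s_f` and the reads are HYPOTHESES; nothing of [15]∕[3]∕[I]
analysis asserted; (c′)‴ NOT closed here (MODULES 95∕96); K0⁷ NOT closed; N07 NOT discharged; counts unmoved; one finite 𝕋⁴ programme at fixed ε — the route closes the conditional
finite-𝕋⁴ rung `BalabanLadder.UV` ONLY; the YM mass gap (Clay) is NOT proved by any of this; nothing continuum ∕ ℝ⁴ ∕ OS.  No `def`, no `instance`, no `notation`, no `sorry`.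

References: [3] (26) p. 22, (62) p. 28, (87)–(92) p. 31, (97)–(100) p. 32, (110) p. 34, (125)–(127) p. 36, Prop. 4 (134)–(135) p. 38; [15] (152)–(156) pp. 301–302, (160) p. 303;
[I] (0.3)–(0.6) pp. 252–253; [4] (1.18) p. 20.
-/

set_option autoImplicit false

noncomputable section

open scoped Matrix.Norms.L2Operator

namespace Summit.QuantumFields.YangMills.BalabanUVNodes.N07DbarNearBondReading

open Literature.MathematicalPhysics.QuantumFieldTheory.Balaban1983to89
open Literature.MathematicalPhysics.QuantumFieldTheory.Balaban1983to89.Node00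
open B16Sect1Backgrounds (toMS)
open B6SectADomainsV1 (Domains)
open GaugeField (gaugeAct)
open MatrixLog (mlog norm_mlog_le_two_mul)
open LatticeFieldCalculus (bondAvgIter)
open B5Eq118OneStroke (iterBlockOf)
open B10Eq27TorusAxialLog (unitsField toUField suIncl gaugeActT gaugeActT_apply val_unitsField)
open Summit.QuantumFields.YangMills.Theorems.Prop8Chart (emlIterU expCfg norm_inv_sub_one_le_two_mul)
open Summit.QuantumFields.YangMills.Theorems.Prop8ChartDoubleBar (vframeU dbarIterU dbarIterU_congr_of_agree norm_vframeU_sub_one_le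
  norm_mlog_dbarIterU_sub_smul_bondAvgIter_le_of_reads)
open Summit.QuantumFields.YangMills.BalabanUVNodes.N07NormalisationDbarFrames (toUT)
open YMDAG.N18.LogConjugation (norm_mul_sub_one_le_of_near)
open Summit.QuantumFields.YangMills.BalabanUVNodes.N07DbarCrossingEnds (dbar_eq_eml_of_cells dbar_eq_eml_mul_vframe_of_outEnd_tgt dbar_eq_vframe_inv_mul_eml_of_outEnd_src
  vframeU_dbar_eq_vframeU_eml_of_block_cells)

/-! ## §1  Two norm rows -/

section NormRows

variable {𝔸 : Type*} [NormedRing 𝔸] [NormOneClass 𝔸]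

/-- `‖v⁻¹·X − 1‖ ≤ 2f + r + 2f·r` when `‖X − 1‖ ≤ r`, `‖v − 1‖ ≤ f ≤ ½` (UST `norm_inv_sub_one_le_two_mul`: `‖v⁻¹ − 1‖ ≤ 2f`). [folklore] -/
theorem norm_inv_mul_sub_one_le_of_le {v : 𝔸ˣ} {X : 𝔸} {r f : ℝ} (hX : ‖X - 1‖ ≤ r) (hv : ‖(v : 𝔸) - 1‖ ≤ f) (hf : f ≤ 1 / 2) :
    ‖((v⁻¹ : 𝔸ˣ) : 𝔸) * X - 1‖ ≤ 2 * f + r + 2 * f * r :=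
  norm_mul_sub_one_le_of_near (norm_inv_sub_one_le_two_mul hv hf) hX

end NormRows

/-! ## §2  The three readings of `U̿^{(l)}(U^u)♮(c)` under the clause of a normalisation family -/

section Readings

variable {P : Params} {N : ℕ} [NeZero N]

variable (D : Domains P) (U : GaugeField P 0 (SU N)) (u gw : GaugeTransf P 0 (SU N))
  (hcl : ∀ (V : (i : ℕ) → Site P i → (Matrix (Fin N) (Fin N) ℂ)ˣ), (∀ x, V 0 x = 1) →
    (∀ (i : ℕ) (y : Site P (i + 1)), V (i + 1) y = V i (emb y) * vframeU (dbarIterU i (unitsField (toUField (gaugeAct u U)))) y) →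
    ∀ (i : ℕ) (y : Site P i), D.LamSite i y → (V i y)⁻¹ * toUT (toMS u i) y = toUT (toMS gw i) y)
include hcl

/-- ★ **CELL–CELL BOND**: if both ends of `c` are cells of `D`, the dictionary gives `Ū^{(l)}_{eml}((U^{gw})♮)(c) = W(c)♮` and `dist1 (W c) ≤ r`, then `‖U̿^{(l)}(U^u)♮(c) − 1‖ ≤ r`.
[cite: Balaban1985Averaging, (87)–(92) p.31, (97)–(99) p.32; Balaban1985Variational, (154) p.302, (160) p.303] -/
theorem norm_dbar_sub_one_le_of_cells {l : ℕ} (c : PBond P l) (hs : D.LamSite l c.src) (ht : D.LamSite l c.tgt)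
    (W : GaugeField P l (SU N)) (hdict : emlIterU l (unitsField (toUField (gaugeAct gw U))) c = unitsField (toUField W) c)
    {r : ℝ} (hrow : dist1 (W c) ≤ r) :
    ‖((dbarIterU l (unitsField (toUField (gaugeAct u U))) c : (Matrix (Fin N) (Fin N) ℂ)ˣ) : Matrix (Fin N) (Fin N) ℂ) - 1‖ ≤ r := by
  rw [dbar_eq_eml_of_cells D U u gw hcl c hs ht, hdict, val_unitsField]
  exact hrow

/-- ★★ **THE BLOCK FRAME OF THE LANDAU COPY's DOUBLE-BAR FIELD OVER A BLOCK OF CELLS IS `2ℓ·s_f`-CLOSE TO `1`**: if every site of `B(y)` is a cell of `D` (level `i`), the dictionary holds on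
the bonds inside `B(y)` (`Ū^{(i)}_{eml}((U^{gw})♮) = W♮` there) with `dist1 (W b) ≤ s_f`, `600ℓ·s_f ≤ 1`: `‖vframeU (U̿^{(i)}(U^u)♮) y − 1‖ ≤ 2ℓ·s_f` (MODULE 93 §2 + UST
`norm_vframeU_sub_one_le`, `ℓ = (d+2)L`). [cite: Balaban1985Averaging, (62) p.28, (110) p.34; Balaban1987RG1, (0.3) p.252; Balaban1985Variational, (160) p.303] -/
theorem norm_vframeU_dbar_sub_one_le_of_block {i : ℕ} (hi : i + 1 ≤ P.m + P.K) (y : Site P (i + 1)) (hblk : ∀ z : Site P i, blockOf z = y → D.LamSite i z)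
    (W : GaugeField P i (SU N))
    (hdict : ∀ b : PBond P i, blockOf b.src = y → blockOf b.tgt = y → emlIterU i (unitsField (toUField (gaugeAct gw U))) b = unitsField (toUField W) b)
    {sf : ℝ} (hsf : 0 ≤ sf) (hℓ : 600 * (((P.d + 2) * P.L : ℕ) : ℝ) * sf ≤ 1)
    (hW : ∀ b : PBond P i, blockOf b.src = y → blockOf b.tgt = y → dist1 (W b) ≤ sf) :
    ‖((vframeU (dbarIterU i (unitsField (toUField (gaugeAct u U)))) y : (Matrix (Fin N) (Fin N) ℂ)ˣ) : Matrix (Fin N) (Fin N) ℂ) - 1‖ ≤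
      2 * (((P.d + 2) * P.L : ℕ) : ℝ) * sf := by
  rw [vframeU_dbar_eq_vframeU_eml_of_block_cells D U u gw hcl hi y hblk]
  refine norm_vframeU_sub_one_le hi y hsf hℓ fun b h1 h2 => ?_
  rw [hdict b h1 h2, val_unitsField]
  exact hW b h1 h2

/-- ★★ **TARGET AN OUT-END OVER A BLOCK OF CELLS**: source a cell, every site of `B(c₊)` a cell of level `i`; the dictionary at `c` (`W`, `dist1 (W c) ≤ r`) and inside `B(c₊)` (`W_b`,
`dist1 ≤ s_f`, `600ℓ·s_f ≤ 1`): `‖U̿^{(i+1)}(U^u)♮(c) − 1‖ ≤ r + 2ℓs_f + r·(2ℓs_f)` (MODULE 93's `… = Ū_{eml}(c)·v(c₊)` and §1).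
[cite: Balaban1985Averaging, (87)–(92) p.31, (97)–(100) p.32, (110) p.34; Balaban1985Variational, (160) p.303] -/
theorem norm_dbar_sub_one_le_of_outEnd_tgt {i : ℕ} (hi : i + 1 ≤ P.m + P.K) (c : PBond P (i + 1)) (hs : D.LamSite (i + 1) c.src)
    (hblk : ∀ z : Site P i, blockOf z = c.tgt → D.LamSite i z)
    (W : GaugeField P (i + 1) (SU N)) (hdict : emlIterU (i + 1) (unitsField (toUField (gaugeAct gw U))) c = unitsField (toUField W) c)
    {r : ℝ} (hrow : dist1 (W c) ≤ r)
    (Wb : GaugeField P i (SU N))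
    (hdictb : ∀ b : PBond P i, blockOf b.src = c.tgt → blockOf b.tgt = c.tgt → emlIterU i (unitsField (toUField (gaugeAct gw U))) b = unitsField (toUField Wb) b)
    {sf : ℝ} (hsf : 0 ≤ sf) (hℓ : 600 * (((P.d + 2) * P.L : ℕ) : ℝ) * sf ≤ 1)
    (hWb : ∀ b : PBond P i, blockOf b.src = c.tgt → blockOf b.tgt = c.tgt → dist1 (Wb b) ≤ sf) :
    ‖((dbarIterU (i + 1) (unitsField (toUField (gaugeAct u U))) c : (Matrix (Fin N) (Fin N) ℂ)ˣ) : Matrix (Fin N) (Fin N) ℂ) - 1‖ ≤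
      r + 2 * (((P.d + 2) * P.L : ℕ) : ℝ) * sf + r * (2 * (((P.d + 2) * P.L : ℕ) : ℝ) * sf) := by
  have hemb : D.LamSite i (emb c.tgt) := hblk (emb c.tgt) (Site.blockOf_emb hi c.tgt)
  rw [dbar_eq_eml_mul_vframe_of_outEnd_tgt D U u gw hcl c hs hemb, Units.val_mul, hdict, val_unitsField]
  exact norm_mul_sub_one_le_of_near hrow (norm_vframeU_dbar_sub_one_le_of_block D U u gw hcl hi c.tgt hblk Wb hdictb hsf hℓ hWb)

/-- ★★ **SOURCE AN OUT-END OVER A BLOCK OF CELLS** (mirror): `‖U̿^{(i+1)}(U^u)♮(c) − 1‖ ≤ 2(2ℓs_f) + r + 2(2ℓs_f)·r` (MODULE 93's `… = v(c₋)⁻¹·Ū_{eml}(c)` and §1; `2ℓs_f ≤ ½` from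
`600ℓ·s_f ≤ 1`). [cite: Balaban1985Averaging, (87)–(92) p.31, (97)–(100) p.32, (110) p.34; Balaban1985Variational, (160) p.303] -/
theorem norm_dbar_sub_one_le_of_outEnd_src {i : ℕ} (hi : i + 1 ≤ P.m + P.K) (c : PBond P (i + 1)) (ht : D.LamSite (i + 1) c.tgt)
    (hblk : ∀ z : Site P i, blockOf z = c.src → D.LamSite i z)
    (W : GaugeField P (i + 1) (SU N)) (hdict : emlIterU (i + 1) (unitsField (toUField (gaugeAct gw U))) c = unitsField (toUField W) c)
    {r : ℝ} (hrow : dist1 (W c) ≤ r)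
    (Wb : GaugeField P i (SU N))
    (hdictb : ∀ b : PBond P i, blockOf b.src = c.src → blockOf b.tgt = c.src → emlIterU i (unitsField (toUField (gaugeAct gw U))) b = unitsField (toUField Wb) b)
    {sf : ℝ} (hsf : 0 ≤ sf) (hℓ : 600 * (((P.d + 2) * P.L : ℕ) : ℝ) * sf ≤ 1)
    (hWb : ∀ b : PBond P i, blockOf b.src = c.src → blockOf b.tgt = c.src → dist1 (Wb b) ≤ sf) :
    ‖((dbarIterU (i + 1) (unitsField (toUField (gaugeAct u U))) c : (Matrix (Fin N) (Fin N) ℂ)ˣ) : Matrix (Fin N) (Fin N) ℂ) - 1‖ ≤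
      2 * (2 * (((P.d + 2) * P.L : ℕ) : ℝ) * sf) + r + 2 * (2 * (((P.d + 2) * P.L : ℕ) : ℝ) * sf) * r := by
  have hemb : D.LamSite i (emb c.src) := hblk (emb c.src) (Site.blockOf_emb hi c.src)
  rw [dbar_eq_vframe_inv_mul_eml_of_outEnd_src D U u gw hcl c hemb ht, Units.val_mul, hdict, val_unitsField]
  have hℓ0 : (0 : ℝ) ≤ (((P.d + 2) * P.L : ℕ) : ℝ) := Nat.cast_nonneg _
  have hf : 2 * (((P.d + 2) * P.L : ℕ) : ℝ) * sf ≤ 1 / 2 := by nlinarith [mul_nonneg hℓ0 hsf]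
  exact norm_inv_mul_sub_one_le_of_le hrow (norm_vframeU_dbar_sub_one_le_of_block D U u gw hcl hi c.src hblk Wb hdictb hsf hℓ hWb) hf

end Readings

/-! ## §3  From `‖U̿ − 1‖` to the near row of `Q_l A` -/

section Linear

variable {P : Params} {N : ℕ} [NeZero N]

omit [NeZero N] in
/-- ★ The logarithm's Lipschitz row at `1` ([3] (26)): `‖log Y‖ ≤ 2x` when `‖Y − 1‖ ≤ x ≤ ½`. [cite: Balaban1985Averaging, (26) p.22] -/
theorem norm_mlog_le_two_mul_of_le {Y : Matrix (Fin N) (Fin N) ℂ} {x : ℝ} (hY : ‖Y - 1‖ ≤ x) (hx : x ≤ 1 / 2) : ‖mlog Y‖ ≤ 2 * x :=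
  (norm_mlog_le_two_mul (hY.trans hx)).trans (by linarith)

/-- ★★★ **THE NEAR ROW OF THE STRAIGHT BLOCK AVERAGE FROM THE DOUBLE-BAR READING**: for `0 < η`, a level-`l` bond `c`, a potential `A` with `‖A b‖ ≤ s` on the fine bonds under the two
`l`-blocks of `c` and the budget `243200·ℓ²·Lˡ·η·s ≤ 1`, and a fine field `X` agreeing with `e^{iηA}` on those bonds: if `‖log U̿^{(l)}X(c)‖ ≤ m` then
`‖Q_lA(c)‖ ≤ (m + 64·60800·ℓ²·(Lˡ·η·s)²)∕(η·Lˡ)` — UST's second-order row `norm_mlog_dbarIterU_sub_smul_bondAvgIter_le_of_reads` after `dbarIterU_congr_of_agree`.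
[cite: Balaban1985Averaging, Prop. 4 (134)–(135) p.38, (125)–(127) p.36; Balaban1985Variational, (152)–(156) pp.301–302; Balaban1984PropagatorsI, (1.18) p.20] -/
theorem norm_bondAvgIter_le_of_dbar_reads (η : ℝ) (hη : 0 < η) {l : ℕ} (hl : l ≤ P.m + P.K) (c : PBond P l)
    (A : PBond P 0 → Matrix (Fin N) (Fin N) ℂ) {s : ℝ} (hs0 : 0 ≤ s)
    (hbudget : 243200 * (((P.d + 2) * P.L : ℕ) : ℝ) ^ 2 * (P.L : ℝ) ^ l * η * s ≤ 1)
    (hA : ∀ b : PBond P 0, (iterBlockOf l b.src = c.src ∨ iterBlockOf l b.src = c.tgt) →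
      (iterBlockOf l b.tgt = c.src ∨ iterBlockOf l b.tgt = c.tgt) → ‖A b‖ ≤ s)
    (X : GaugeField P 0 (Matrix (Fin N) (Fin N) ℂ)ˣ)
    (hagree : ∀ b : PBond P 0, (iterBlockOf l b.src = c.src ∨ iterBlockOf l b.src = c.tgt) →
      (iterBlockOf l b.tgt = c.src ∨ iterBlockOf l b.tgt = c.tgt) → X b = expCfg η A b)
    {m : ℝ} (hm : ‖mlog ((dbarIterU l X c : (Matrix (Fin N) (Fin N) ℂ)ˣ) : Matrix (Fin N) (Fin N) ℂ)‖ ≤ m) :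
    ‖bondAvgIter l A c‖ ≤ (m + 64 * 60800 * (((P.d + 2) * P.L : ℕ) : ℝ) ^ 2 * ((P.L : ℝ) ^ l * η * s) ^ 2) / (η * (P.L : ℝ) ^ l) := by
  have hX : dbarIterU l X c = dbarIterU l (expCfg η A) c := dbarIterU_congr_of_agree l hl c hagree
  have h2 := norm_mlog_dbarIterU_sub_smul_bondAvgIter_le_of_reads (n := Fin N) η hη hl c A hs0 hbudget hA
  rw [← hX] at h2
  have hL0 : (0 : ℝ) < (P.L : ℝ) ^ l := pow_pos (by exact_mod_cast P.L_pos) l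
  have hηL : 0 < η * (P.L : ℝ) ^ l := mul_pos hη hL0
  -- `‖(iηLˡ)•Q‖ ≤ m + R`
  have h3 : ‖((Complex.I * (η : ℂ)) * ((P.L : ℕ) : ℂ) ^ l) • bondAvgIter l A c‖ ≤
      m + 64 * 60800 * (((P.d + 2) * P.L : ℕ) : ℝ) ^ 2 * ((P.L : ℝ) ^ l * η * s) ^ 2 := by
    have e : ((Complex.I * (η : ℂ)) * ((P.L : ℕ) : ℂ) ^ l) • bondAvgIter l A c =
        mlog ((dbarIterU l X c : (Matrix (Fin N) (Fin N) ℂ)ˣ) : Matrix (Fin N) (Fin N) ℂ) -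
          (mlog ((dbarIterU l X c : (Matrix (Fin N) (Fin N) ℂ)ˣ) : Matrix (Fin N) (Fin N) ℂ) -
            ((Complex.I * (η : ℂ)) * ((P.L : ℕ) : ℂ) ^ l) • bondAvgIter l A c) := by abel
    rw [e]
    exact (norm_sub_le _ _).trans (add_le_add hm h2)
  have hnorm : ‖(Complex.I * (η : ℂ)) * ((P.L : ℕ) : ℂ) ^ l‖ = η * (P.L : ℝ) ^ l := by
    rw [norm_mul, norm_mul, Complex.norm_I, one_mul, norm_pow, Complex.norm_natCast, Complex.norm_real, Real.norm_of_nonneg hη.le]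
  rw [norm_smul, hnorm] at h3
  rw [le_div_iff₀ hηL]
  linarith [h3]

end Linear

end Summit.QuantumFields.YangMills.BalabanUVNodes.N07DbarNearBondReading

end
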